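/-
Copyright (c) 2026. All rights reserved.
Released under Apache 2.0 license as described in the file LICENSE.
Authors: abc-iut cell, seat abc-iut-f-197 (block F fact-proving wave, tranche 197; proof-only companion of
abc-iut-L6-t4's `GlobalPacketsLGP.lean`).
-/
import Literature.IUT.LogThetaLattice.GlobalPacketsLGPProofs
import Literature.IUT.LogThetaLattice.GlobalPacketsLGPNegative33i
import HarnessLib

/-!
# [IUTchIII] Prop 3.3 (i): the FACT-LIST row `Prop33i_directSumOfNumberFields'` at THE named instances — `_holds`

S. Mochizuki, *Inter-universal Teichmüller theory III*, kurims manuscript (May 2020), Proposition 3.3 (i) p. 100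
("`(†𝕄⊛_mod)_A` decomposes, uniquely, as a direct sum of number fields"; the `(†𝕄⊛_mod)_α`, `α ∈ A`, are
labelled copies of the number field `F_mod`, [IUTchII] Cor. 4.8 (i)) [claim: Mochizuki2012, status: disputed]
(D-0012 claim key; the item is the classical fact that a finite tensor product over `ℚ` of number fields is a
finite product of number fields — finite étale `ℚ`-algebra; this file takes no side on [IUTchIII] Cor. 3.12 and
asserts nothing about abc).

PROOF-ONLY companion (cell abc-iut, seat abc-iut-f-197, F fact-proving wave, FROZEN FACT-LIST row **F-2099**
`Prop33i_directSumOfNumberFields'`; no definition, no statement re-typed; the declaring file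
`GlobalPacketsLGP.lean` (abc-iut-L6-t4) is imported through its proof companions, never edited).

The row is a SCHEMA (plan rule R5): by Lean's section-variable rule the `[∀ α, NumberField (F α)]` binder of the
primed def was dropped (finding G-BINDER-DROP), so the constant quantifies over ARBITRARY fields `F α` of
characteristic `0`, and its universal closure is FALSE — `not_Prop33i_directSumOfNumberFields'_real`
(`GlobalPacketsLGPNegative33i.lean`: at `A = Unit`, `F = fun _ => ℝ` the packet is uncountable).  It is
consumable AT NAMED INSTANCES ONLY, and THE instance the text prints is: `F α` a NUMBER FIELD for every
`α ∈ A` (indeed a copy of `F_mod`).  This file records, BY NAME from landed theorems (abc-iut-L6-t5,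
`GlobalPacketsLGPProofs.lean`, p405908):

* `prop33i_directSumOfNumberFields'_holds` — **F-2099 HOLDS at THE instance**: for every finite `A` and every
  family of NUMBER FIELDS `F α`, `Prop33i_directSumOfNumberFields' F` (`…'_of_numberField` by name; FQ type);
* `prop33i_directSumOfNumberFields'_holds_copies` — the literal printed instance, `A` labelled copies of ONE
  number field `F_mod`;
* `prop33i_directSumOfNumberFields'_holds_and_not_schema` — the R5 record in one line: the instance form at
  number fields holds AND the schema fails at `F = fun _ => ℝ`.

Sibling rows: F-2098 (unprimed, same body) «instance form PROVED», F-2100 (`…''`, binders in the header)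
«proved(_holds)» — this file gives F-2099 the same standing.  Nothing here is new mathematics.
-/

namespace Literature.IUT.LogThetaLattice

universe u v

section F2099

variable {A : Type v} [Fintype A] [DecidableEq A]
variable (F : A → Type u) [∀ α, Field (F α)] [∀ α, NumberField (F α)] [∀ α, Algebra ℚ (F α)]

omit [DecidableEq A] in
/-- **FACT-LIST row F-2099 `Prop33i_directSumOfNumberFields'` HOLDS at THE named instance** ([IUTchIII]
Prop 3.3 (i) p. 100: "`(†𝕄⊛_mod)_A` decomposes, uniquely, as a direct sum of number fields"): for every finite
index set `A` and every family of NUMBER FIELDS `F α` (with their `ℚ`-algebra structures), the global tensor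
packet `⊗_{α∈A} F α` is ring-isomorphic to a finite product of number fields — abc-iut-L6-t5's
`Prop33i_directSumOfNumberFields'_of_numberField` BY NAME (étale-algebra route), fully-qualified type.  R5:
instance form; the universal closure over arbitrary fields is false (`not_Prop33i_directSumOfNumberFields'_real`).
[claim: Mochizuki2012, status: disputed] -/
theorem prop33i_directSumOfNumberFields'_holds :
    Literature.IUT.LogThetaLattice.Prop33i_directSumOfNumberFields' F :=
  Prop33i_directSumOfNumberFields'_of_numberField F

end F2099

/-- **F-2099 at the literal printed instance**: `A` labelled copies `(†𝕄⊛_mod)_α ≅ F_mod` of ONE number field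
`F_mod` ([IUTchII] Cor. 4.8 (i); [IUTchIII] Prop 3.3 (i) p. 100) — `⊗_{α∈A} F_mod` is a finite product of number
fields. [claim: Mochizuki2012, status: disputed] -/
theorem prop33i_directSumOfNumberFields'_holds_copies (Fmod : Type u) [Field Fmod] [NumberField Fmod]
    (A : Type v) [Fintype A] :
    Literature.IUT.LogThetaLattice.Prop33i_directSumOfNumberFields' (fun _ : A => Fmod) :=
  prop33i_directSumOfNumberFields'_holds fun _ : A => Fmod

/-- **R5 record for F-2099**: the instance form at number fields holds (every finite family of number fields,
`prop33i_directSumOfNumberFields'_holds`) while the schema — whose `[NumberField]` binder was dropped — FAILS at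
the junk parameter `A = Unit`, `F = fun _ => ℝ` (`not_Prop33i_directSumOfNumberFields'_real`): consumable at the
named instances only, never as a universal closure. [claim: Mochizuki2012, status: disputed] -/
theorem prop33i_directSumOfNumberFields'_holds_and_not_schema :
    (∀ (A : Type) [Fintype A] (F : A → Type) [∀ α, Field (F α)] [∀ α, NumberField (F α)]
        [∀ α, Algebra ℚ (F α)], Literature.IUT.LogThetaLattice.Prop33i_directSumOfNumberFields' F) ∧
      ¬ Literature.IUT.LogThetaLattice.Prop33i_directSumOfNumberFields' (A := Unit) (fun _ => ℝ) :=
  ⟨fun _ _ F _ _ _ => prop33i_directSumOfNumberFields'_holds F, not_Prop33i_directSumOfNumberFields'_real⟩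

end Literature.IUT.LogThetaLattice
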